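import Summits.CriticalPhenomena.PercolationContinuityZ3.Theorems.Transplant.SkelPhiCorridorKGKits
import Summits.CriticalPhenomena.PercolationContinuityZ3.Theorems.Transplant.SkelPhiParaCorridorKGYRead
import HarnessLib

/-!
# N2 (frames-only node `SamePDropOfSkeletonFrm₁`, OPEN), (C) column: **THE PER-CENTRE INPUT OF THE y′-RUN PHASE** (second-axis K-G corridor) —
# `hroute_yRunB` / `hroute_yRunBIn`: every centre of a level of the widened y′-run `yRunSchedB` (axis `oth 0` of the x-run frame) strides; its route
# datum comes from the long y′-link of its steered TOP piece `pgTopPieceW … σ τₖ v` at accuracy `δ³` (`routeSetsW` / `routeSetsWIn` on the readings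
# `yRunB_mem_region_of_link` / `yRunB_mem_core_succ_of_piece`).  Phases 2 and 3 use `hroute_xParkC(In)` / `hroute_yParkC(In)` (SkelPhiCorridorKGKits).
builds on p205010 (kernel theorem, internal audit signed; external expert review pending) — nothing in this file uses p205010; nothing here is a
claim about the open node `SamePDropOfSkeletonFrm₁`.
Lane `prim-bschramm`, seat `prim-bschramm-p5` (gen 15; (C) lineage); helper file (`--supports stmt-CriticalPhenomena-4575 --as helper`).
[cite: KozmaNitzan2024, §4 Lemma 10 Step IV (pp. 20–21), Lemma 11 (pp. 22–23)] [cite: MartineauTassion2017, §4.3 Lemma 4.2]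
-/

noncomputable section

open scoped Classical

namespace Summit.CriticalPhenomena.PercolationContinuityZ3.Theorems.Transplant

namespace Skelφ

open MeasureTheory
open Literature.Probability.Percolation Literature.Probability.LatticeModels SimpleGraph KNLevels
open Literature.Barriers.CriticalPhenomena (graphBall graphBall_mono)
open Skel (winGraph winGraph_le winGraphIn winGraphIn_le)
open ChainPlanar ChainPara

variable {V : Type} [DecidableEq V] [Countable V] {G : SimpleGraph V} [G.LocallyFinite] {φ : V → Site 2}

section RunYB

variable {n ℓ : ℕ} {h v : ℤ} (hn : 1 ≤ n) (hv : |v| ≤ n) (hlay : (n + h.natAbs : ℕ) ≤ (n : ℤ) * ℓ + 1) (R' qq W N : ℕ)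

/-- **Per-centre input, y′-run level (plain law)**: every centre strides; route datum from the long y′-link of its steered top piece.
[cite: KozmaNitzan2024, §4 Lemma 10 Step IV, Lemma 11] [cite: MartineauTassion2017, §4.3 Lemma 4.2] -/
theorem hroute_yRunB (c₀ : V) {σ : ℤ} (hσ : σ = 1 ∨ σ = -1) {k : ℕ} {w₀ : V} {R r Rl : ℕ} (hr : Rl ≤ r) (hrR : r ≤ R) {Dr T : Finset V}
    (hPD : Win G (runX φ c₀ n h σ) w₀ ((yRunSchedB hn hv hlay R' qq W N).region k) R ⊆ Dr)
    (hPT : Win G (runX φ c₀ n h σ) w₀ ((yRunSchedB hn hv hlay R' qq W N).core (k + 1)) R ⊆ T)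
    {q : unitInterval} {Wt : Sym2 V → unitInterval} (hWD : IsSubbox (winGraph G w₀ R) Wt q Dr) (Λc : V → ℕ → Finset V) (kz : ℕ) {δ : ℝ}
    (hlongY : ∀ c (τ : ℤ), τ = 1 ∨ τ = -1 → 1 - δ ^ 3 < (bondPercolation G q).real
      (linkIn (pgramPrism G φ c n h (3 * ℓ) Rl) (Λc c kz) (pgTopPieceW G φ c n h ℓ Rl σ τ v))) :
    ∀ c : V, runX φ c₀ n h σ c ∈ Finset.Icc ((yRunSchedB hn hv hlay R' qq W N).lo k - (((yRunSchedB hn hv hlay R' qq W N).R' : ℕ) : Site 2))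
        ((yRunSchedB hn hv hlay R' qq W N).hi k + (((yRunSchedB hn hv hlay R' qq W N).R' : ℕ) : Site 2)) → c ∈ graphBall G w₀ (R - r) →
      c ∈ T ∨ ∃ Qt Ft : Finset V, Ft ⊆ T ∧ Qt ⊆ Dr ∧ 1 - δ ^ 3 ≤ (prodBernoulli Wt).real (linkIn (↑Qt : Set V) (Λc c kz) Ft) := by
  intro c hcI hcw
  refine Or.inr ?_
  obtain ⟨Qt, Ft, hFT, hQD, hlt⟩ := routeSetsW (ψ := runX φ c₀ n h σ) h ℓ hcw hr hrR (coe_pgTopPieceW_subset (G := G) (φ := φ) c n h ℓ Rl σ _ v)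
    (fun w hw => yRunB_mem_region_of_link hn hv hlay R' qq W N c₀ hσ hcI hw)
    (fun w hw => yRunB_mem_core_succ_of_piece hn hv hlay R' qq W N c₀ hσ hcI hw) hPD hPT hWD
    (hlongY c _ ((yRunPrmB n ℓ h v R' qq W N).steer_eq_or k _))
  exact ⟨Qt, Ft, hFT, hQD, hlt.le⟩

/-- (Habitat law.) **Per-centre input, y′-run level.** [cite: KozmaNitzan2024, §4 Lemma 10 Step IV, Lemma 11] -/
theorem hroute_yRunBIn (c₀ : V) {σ : ℤ} (hσ : σ = 1 ∨ σ = -1) {k : ℕ} {w₀ : V} {R r Rl : ℕ} (hr : Rl ≤ r) (hrR : r ≤ R) {Dr T : Finset V}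
    (hPD : Win G (runX φ c₀ n h σ) w₀ ((yRunSchedB hn hv hlay R' qq W N).region k) R ⊆ Dr)
    (hPT : Win G (runX φ c₀ n h σ) w₀ ((yRunSchedB hn hv hlay R' qq W N).core (k + 1)) R ⊆ T)
    {Ω : Finset V} (hDrΩ : Dr ⊆ Ω) {q : unitInterval} {Wt : Sym2 V → unitInterval} (hWD : IsSubbox (winGraphIn G Ω) Wt q Dr)
    (Λc : V → ℕ → Finset V) (kz : ℕ) {δ : ℝ}
    (hlongY : ∀ c (τ : ℤ), τ = 1 ∨ τ = -1 → 1 - δ ^ 3 < (bondPercolation G q).real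
      (linkIn (pgramPrism G φ c n h (3 * ℓ) Rl) (Λc c kz) (pgTopPieceW G φ c n h ℓ Rl σ τ v))) :
    ∀ c : V, runX φ c₀ n h σ c ∈ Finset.Icc ((yRunSchedB hn hv hlay R' qq W N).lo k - (((yRunSchedB hn hv hlay R' qq W N).R' : ℕ) : Site 2))
        ((yRunSchedB hn hv hlay R' qq W N).hi k + (((yRunSchedB hn hv hlay R' qq W N).R' : ℕ) : Site 2)) → c ∈ graphBall G w₀ (R - r) →
      c ∈ T ∨ ∃ Qt Ft : Finset V, Ft ⊆ T ∧ Qt ⊆ Dr ∧ 1 - δ ^ 3 ≤ (prodBernoulli Wt).real (linkIn (↑Qt : Set V) (Λc c kz) Ft) := by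
  intro c hcI hcw
  refine Or.inr ?_
  obtain ⟨Qt, Ft, hFT, hQD, hlt⟩ := routeSetsWIn (ψ := runX φ c₀ n h σ) h ℓ hcw hr hrR (coe_pgTopPieceW_subset (G := G) (φ := φ) c n h ℓ Rl σ _ v)
    (fun w hw => yRunB_mem_region_of_link hn hv hlay R' qq W N c₀ hσ hcI hw)
    (fun w hw => yRunB_mem_core_succ_of_piece hn hv hlay R' qq W N c₀ hσ hcI hw) hPD hPT hDrΩ hWD
    (hlongY c _ ((yRunPrmB n ℓ h v R' qq W N).steer_eq_or k _))
  exact ⟨Qt, Ft, hFT, hQD, hlt.le⟩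

end RunYB

end Skelφ

end Summit.CriticalPhenomena.PercolationContinuityZ3.Theorems.Transplant

end
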